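import Literature.Claims.NS.Tsionskiy2025
import Literature.Barriers.NavierStokesRegularity.SupNormGainObstruction
import Mathlib.Analysis.SpecialFunctions.Gaussian.FourierTransform
import HarnessLib

/-!
# C15 `Tsionskiy2025` — kernel refutation of Step 3 (Theorem 6.2, (6.32)/(6.33) p. 138) and of
# its abstract grain `Step_3Abs` by a closed-form Gaussian probe

Cell `ns-claims` (D-0090); kill kit written by ns-claims-salvage-p6 for ns-claims-refuter-6/7
(interim convention (b)); the VERDICT line and the per-step table of the earlier Steps
(TYPING-HYGIENE 11) are the refuter's (claims/Tsionskiy2025/REFUTER.md), the RETYPE is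
ns-claims-ref-4's (RA / RA-b / RA-c). Skeleton: `Literature.Claims.NS.Tsionskiy2025` (p462200, p463109).

Witness (no limits, no tail estimates): (i) `e^{−y} + e^{−1/y} ≤ 1` (`1 + x + x²/2 ≤ eˣ`), hence
the low-pass symbol dominates a heat symbol, `symbE ε γ = 1 − δ(γ) ≥ exp(−|γ|²/ε³)`; (ii) for the
Gaussian probe `g_a = e^{−a|x|²}`, `mulOp m g_a 0 = ∫ m(−2πξ) (π/a)^{3/2} e^{−π²|ξ|²/a} dξ` is
monotone in the symbol and equals `(1/(1+4aτ))^{3/2}` for the heat symbol `exp(−τ|γ|²)` (the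
mechanism of the barrier entry `Literature.Barriers.NavierStokesRegularity.SupNormGainObstruction`,
p463095: a symbol equal to `1` at `ξ = 0` is never `ε`-small on `L^∞`); (iii) `ε = e⁻²`,
`a = ε³/40`, `τ = 1/ε³`: `supNorm (E g_a) ≥ (10/11)^{3/2} ≥ 100/121 > 1/3 ≥ ε·supNorm g_a` —
`¬ Eq632`; `u⃗ = (g_a, g_a, g_a) ∈ →TS` — `¬ Step_3`; the heat symbol itself meets every printed
hypothesis (6.22)/(6.28) of `Step_3Abs` — `¬ Step_3Abs`.

WHAT THIS IS NOT: not a claim about NS regularity or blow-up; not a claim about any author beyond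
the typed locator.
-/

set_option linter.dupNamespace false

noncomputable section

open MeasureTheory Real Set Filter Complex
open scoped FourierTransform RealInnerProductSpace

namespace Summit.NavierStokesRegularity.NavierStokesRegularity.Theorems.Tsionskiy2025

open Literature.Claims.NS.Tsionskiy2025
open Literature.Analysis.FluidPDE (HasRapidSpatialDecay)

/-! ## 1. The elementary inequality and the heat-symbol minorant of `1 − δ` -/

/-- `e^{−y} + e^{−1/y} ≤ 1` for `y > 0`: from `1 + x + x²/2 ≤ eˣ` (`x ≥ 0`) at `x = y` and
`x = 1/y`, `1/(1+y+y²/2) + 1/(1+1/y+1/(2y²)) ≤ 1`. -/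
theorem exp_neg_add_exp_neg_inv_le_one {y : ℝ} (hy : 0 < y) :
    Real.exp (-y) + Real.exp (-(1 / y)) ≤ 1 := by
  have hA := Real.quadratic_le_exp_of_nonneg hy.le
  have hB := Real.quadratic_le_exp_of_nonneg (one_div_pos.2 hy).le
  have hA0 : 0 < 1 + y + y ^ 2 / 2 := by positivity
  have hB0 : 0 < 1 + 1 / y + (1 / y) ^ 2 / 2 := by positivity
  have h1 : Real.exp (-y) ≤ 1 / (1 + y + y ^ 2 / 2) := by
    rw [Real.exp_neg, ← one_div]
    exact one_div_le_one_div_of_le hA0 hA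
  have h2 : Real.exp (-(1 / y)) ≤ 1 / (1 + 1 / y + (1 / y) ^ 2 / 2) := by
    rw [Real.exp_neg, ← one_div]
    exact one_div_le_one_div_of_le hB0 hB
  have h3 : 1 / (1 + y + y ^ 2 / 2) + 1 / (1 + 1 / y + (1 / y) ^ 2 / 2) ≤ 1 := by
    rw [div_add_div _ _ hA0.ne' hB0.ne', div_le_one (mul_pos hA0 hB0)]
    have hy' : y ≠ 0 := hy.ne'
    field_simp
    nlinarith [hy, sq_nonneg y, mul_pos hy hy, mul_pos (mul_pos hy hy) hy]
  linarith

/-- **The low-pass symbol dominates a heat symbol**: `exp(−|γ|²/ε³) ≤ 1 − δ(γ) = symbE ε γ` for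
every `γ` (`ε > 0`). -/
theorem exp_neg_norm_sq_le_symbE {ε : ℝ} (hε : 0 < ε) (γ : (EuclideanSpace ℝ (Fin 3))) :
    Real.exp (-(1 / ε ^ 3) * ‖γ‖ ^ 2) ≤ symbE ε γ := by
  unfold symbE cutoff
  split_ifs with hγ
  · subst hγ
    simp
  · have hγ' : 0 < ‖γ‖ := norm_pos_iff.2 hγ
    have hy : 0 < ‖γ‖ ^ 2 / ε ^ 3 := by positivity
    have h := exp_neg_add_exp_neg_inv_le_one hy
    have e1 : -(1 / ε ^ 3) * ‖γ‖ ^ 2 = -(‖γ‖ ^ 2 / ε ^ 3) := by ring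
    have e2 : -ε ^ 3 / ‖γ‖ ^ 2 = -(1 / (‖γ‖ ^ 2 / ε ^ 3)) := by
      field_simp
    rw [e1, e2]
    linarith

/-- The cutoff `δ` of (3.11) is measurable (piecewise: `0` at the origin, `exp(−ε³/|γ|²)` elsewhere). -/
theorem measurable_cutoff (ε : ℝ) : Measurable (cutoff ε) := by
  unfold cutoff
  refine Measurable.ite ?_ measurable_const ?_
  · simp only [Set.setOf_eq_eq_singleton]
    exact measurableSet_singleton 0
  · exact (by fun_prop : Measurable fun γ : (EuclideanSpace ℝ (Fin 3)) => Real.exp (-(ε ^ 3) / ‖γ‖ ^ 2))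

/-- The low-pass symbol `1 − δ` is measurable. -/
theorem measurable_symbE (ε : ℝ) : Measurable (symbE ε) :=
  measurable_const.sub (measurable_cutoff ε)

/-- The low-pass symbol satisfies `1 − δ ≤ 1` ((6.22), true). -/
theorem symbE_le_one (ε : ℝ) (γ : (EuclideanSpace ℝ (Fin 3))) : symbE ε γ ≤ 1 := by
  unfold symbE cutoff
  split_ifs
  · simp
  · linarith [Real.exp_pos (-(ε ^ 3) / ‖γ‖ ^ 2)]

/-! ## 2. The Gaussian probe through the paper's Fourier multiplier `mulOp` -/

/-- Fourier transform (Mathlib convention) of the real Gaussian `e^{−a|x|²}` cast to `ℂ`: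
`(π/a)^{3/2} e^{−π²|ξ|²/a}` (real, nonnegative). -/
theorem fourier_ofReal_gauss {a : ℝ} (ha : 0 < a) (ξ : (EuclideanSpace ℝ (Fin 3))) :
    𝓕 (fun y : (EuclideanSpace ℝ (Fin 3)) => ((Real.exp (-a * ‖y‖ ^ 2) : ℝ) : ℂ)) ξ =
      (((π / a) ^ ((Module.finrank ℝ (EuclideanSpace ℝ (Fin 3)) : ℝ) / 2) * Real.exp (-(π ^ 2 / a) * ‖ξ‖ ^ 2) : ℝ) : ℂ) := by
  have hb : 0 < ((a : ℂ)).re := by simpa using ha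
  have hfun : (fun y : (EuclideanSpace ℝ (Fin 3)) => ((Real.exp (-a * ‖y‖ ^ 2) : ℝ) : ℂ)) =
      fun v : (EuclideanSpace ℝ (Fin 3)) => cexp (-(a : ℂ) * ‖v‖ ^ 2) := by
    funext y
    push_cast
    ring_nf
  rw [hfun, fourier_gaussian_innerProductSpace hb ξ]
  have hπa : (0 : ℝ) ≤ π / a := by positivity
  push_cast
  rw [Complex.ofReal_cpow hπa]
  push_cast
  ring_nf

/-- The integrand `ξ ↦ m(−2πξ) · 𝓕 g_a(ξ)` of `mulOp m g_a` is the cast of a real function. -/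
theorem mulOp_gauss_integrand {m : (EuclideanSpace ℝ (Fin 3)) → ℝ} {a : ℝ} (ha : 0 < a) (ξ : (EuclideanSpace ℝ (Fin 3))) :
    ((m (-((2 * π) • ξ)) : ℝ) : ℂ) * 𝓕 (fun y : (EuclideanSpace ℝ (Fin 3)) => ((Real.exp (-a * ‖y‖ ^ 2) : ℝ) : ℂ)) ξ =
      ((m (-((2 * π) • ξ)) * ((π / a) ^ ((Module.finrank ℝ (EuclideanSpace ℝ (Fin 3)) : ℝ) / 2) *
        Real.exp (-(π ^ 2 / a) * ‖ξ‖ ^ 2)) : ℝ) : ℂ) := by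
  rw [fourier_ofReal_gauss ha]
  push_cast
  ring

/-- **`mulOp` at the origin on the Gaussian probe is a real Gaussian-weighted integral of the
symbol**: `mulOp m g_a 0 = ∫ m(−2πξ) (π/a)^{3/2} e^{−π²|ξ|²/a} dξ`. -/
theorem mulOp_gauss_zero (m : (EuclideanSpace ℝ (Fin 3)) → ℝ) {a : ℝ} (ha : 0 < a) :
    mulOp m (fun y : (EuclideanSpace ℝ (Fin 3)) => Real.exp (-a * ‖y‖ ^ 2)) 0 =
      ∫ ξ : (EuclideanSpace ℝ (Fin 3)), m (-((2 * π) • ξ)) *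
        ((π / a) ^ ((Module.finrank ℝ (EuclideanSpace ℝ (Fin 3)) : ℝ) / 2) * Real.exp (-(π ^ 2 / a) * ‖ξ‖ ^ 2)) := by
  unfold mulOp
  rw [Real.fourierInv_eq]
  simp only [inner_zero_right, AddChar.map_zero_eq_one, one_smul]
  simp_rw [mulOp_gauss_integrand ha]
  rw [integral_complex_ofReal, Complex.ofReal_re]

/-- The Gaussian weight `(π/a)^{3/2} e^{−π²|ξ|²/a}` is integrable. -/
theorem integrable_gaussWeight {a : ℝ} (ha : 0 < a) :
    Integrable (fun ξ : (EuclideanSpace ℝ (Fin 3)) => (π / a) ^ ((Module.finrank ℝ (EuclideanSpace ℝ (Fin 3)) : ℝ) / 2) *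
      Real.exp (-(π ^ 2 / a) * ‖ξ‖ ^ 2)) := by
  have hc : 0 < π ^ 2 / a := by positivity
  have hint : Integrable (fun ξ : (EuclideanSpace ℝ (Fin 3)) => Real.exp (-(π ^ 2 / a) * ‖ξ‖ ^ 2)) := by
    by_contra h
    have h1 := GaussianFourier.integral_rexp_neg_mul_sq_norm (V := (EuclideanSpace ℝ (Fin 3))) hc
    rw [integral_undef h] at h1
    exact (by positivity : 0 < (π / (π ^ 2 / a)) ^ ((Module.finrank ℝ (EuclideanSpace ℝ (Fin 3)) : ℝ) / 2)).ne h1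
  exact hint.const_mul _

/-- `‖−(2π)ξ‖² = (2π)²‖ξ‖²`. -/
theorem norm_neg_two_pi_smul_sq (ξ : (EuclideanSpace ℝ (Fin 3))) : ‖-((2 * π) • ξ)‖ ^ 2 = (2 * π) ^ 2 * ‖ξ‖ ^ 2 := by
  rw [norm_neg, norm_smul, Real.norm_eq_abs, abs_of_pos (by positivity : (0:ℝ) < 2 * π)]
  ring

/-- A bounded measurable symbol times the Gaussian weight is integrable. -/
theorem integrable_symbol_mul_gaussWeight {m : (EuclideanSpace ℝ (Fin 3)) → ℝ} (hm : Measurable m) {c : ℝ}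
    (hmb : ∀ γ, |m γ| ≤ c) {a : ℝ} (ha : 0 < a) :
    Integrable (fun ξ : (EuclideanSpace ℝ (Fin 3)) => m (-((2 * π) • ξ)) *
      ((π / a) ^ ((Module.finrank ℝ (EuclideanSpace ℝ (Fin 3)) : ℝ) / 2) * Real.exp (-(π ^ 2 / a) * ‖ξ‖ ^ 2))) := by
  have h1 : Measurable (fun ξ : (EuclideanSpace ℝ (Fin 3)) => -((2 * π) • ξ)) := (measurable_const_smul (2 * π)).neg
  have h2 : Measurable (fun ξ : (EuclideanSpace ℝ (Fin 3)) => m (-((2 * π) • ξ))) := hm.comp h1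
  have h3 : Measurable (fun ξ : (EuclideanSpace ℝ (Fin 3)) =>
      (π / a) ^ ((Module.finrank ℝ (EuclideanSpace ℝ (Fin 3)) : ℝ) / 2) * Real.exp (-(π ^ 2 / a) * ‖ξ‖ ^ 2)) :=
    (continuous_const.mul (by fun_prop : Continuous fun ξ : (EuclideanSpace ℝ (Fin 3)) =>
      Real.exp (-(π ^ 2 / a) * ‖ξ‖ ^ 2))).measurable
  refine Integrable.mono' ((integrable_gaussWeight ha).const_mul c) (h2.mul h3).aestronglyMeasurable
    (Eventually.of_forall fun ξ => ?_)
  have hw : 0 ≤ (π / a) ^ ((Module.finrank ℝ (EuclideanSpace ℝ (Fin 3)) : ℝ) / 2) * Real.exp (-(π ^ 2 / a) * ‖ξ‖ ^ 2) := by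
    positivity
  rw [Real.norm_eq_abs, abs_mul, abs_of_nonneg hw]
  exact mul_le_mul_of_nonneg_right (hmb _) hw

/-- **The heat symbol on the Gaussian probe, closed form**:
`∫ e^{−τ|2πξ|²} (π/a)^{3/2} e^{−π²|ξ|²/a} dξ = (1/(1+4aτ))^{3/2}` (a Gaussian integral; this is
`e^{τΔ} g_a (0)`, cf. `Literature.Barriers.NavierStokesRegularity.heatExtension_exp_neg_mul_norm_sq`). -/
theorem integral_heatSymbol_gaussWeight {τ a : ℝ} (hτ : 0 < τ) (ha : 0 < a) :
    ∫ ξ : (EuclideanSpace ℝ (Fin 3)), Real.exp (-τ * ‖-((2 * π) • ξ)‖ ^ 2) *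
        ((π / a) ^ ((Module.finrank ℝ (EuclideanSpace ℝ (Fin 3)) : ℝ) / 2) * Real.exp (-(π ^ 2 / a) * ‖ξ‖ ^ 2)) =
      (1 / (1 + 4 * a * τ)) ^ ((Module.finrank ℝ (EuclideanSpace ℝ (Fin 3)) : ℝ) / 2) := by
  have hcomb : ∀ ξ : (EuclideanSpace ℝ (Fin 3)), Real.exp (-τ * ‖-((2 * π) • ξ)‖ ^ 2) *
      ((π / a) ^ ((Module.finrank ℝ (EuclideanSpace ℝ (Fin 3)) : ℝ) / 2) * Real.exp (-(π ^ 2 / a) * ‖ξ‖ ^ 2)) =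
      (π / a) ^ ((Module.finrank ℝ (EuclideanSpace ℝ (Fin 3)) : ℝ) / 2) *
        Real.exp (-((2 * π) ^ 2 * τ + π ^ 2 / a) * ‖ξ‖ ^ 2) := fun ξ => by
    rw [norm_neg_two_pi_smul_sq, mul_left_comm, ← Real.exp_add]
    congr 2
    ring
  simp_rw [hcomb]
  have hc : 0 < (2 * π) ^ 2 * τ + π ^ 2 / a := by positivity
  rw [integral_const_mul, GaussianFourier.integral_rexp_neg_mul_sq_norm hc,
    ← Real.mul_rpow (by positivity) (by positivity)]
  congr 1
  have ha0 : a ≠ 0 := ha.ne'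
  have hπ0 : (π : ℝ) ≠ 0 := Real.pi_pos.ne'
  have hden : (2 * π) ^ 2 * τ + π ^ 2 / a ≠ 0 := hc.ne'
  have hden' : 1 + 4 * a * τ ≠ 0 := by positivity
  field_simp
  ring

/-- **Monotone lower bound (heat comparison)**: if the measurable symbol `m` satisfies
`exp(−τ|γ|²) ≤ m(γ) ≤ 1`, then `(1/(1+4aτ))^{3/2} ≤ mulOp m g_a 0`
(`mulOp_gauss_zero` + monotonicity of the integral + `integral_heatSymbol_gaussWeight`). -/
theorem mulOp_gauss_zero_ge {m : (EuclideanSpace ℝ (Fin 3)) → ℝ} (hm : Measurable m) {τ a : ℝ} (hτ : 0 < τ) (ha : 0 < a)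
    (hle : ∀ γ, Real.exp (-τ * ‖γ‖ ^ 2) ≤ m γ) (hm1 : ∀ γ, m γ ≤ 1) :
    (1 / (1 + 4 * a * τ)) ^ ((Module.finrank ℝ (EuclideanSpace ℝ (Fin 3)) : ℝ) / 2) ≤
      mulOp m (fun y : (EuclideanSpace ℝ (Fin 3)) => Real.exp (-a * ‖y‖ ^ 2)) 0 := by
  rw [mulOp_gauss_zero m ha, ← integral_heatSymbol_gaussWeight hτ ha]
  have hmb : ∀ γ, |m γ| ≤ 1 := fun γ =>
    abs_le.2 ⟨by linarith [hle γ, Real.exp_pos (-τ * ‖γ‖ ^ 2)], hm1 γ⟩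
  have hhb : ∀ γ : (EuclideanSpace ℝ (Fin 3)), |Real.exp (-τ * ‖γ‖ ^ 2)| ≤ 1 := fun γ => by
    rw [abs_of_pos (Real.exp_pos _), Real.exp_le_one_iff]
    nlinarith [sq_nonneg ‖γ‖, hτ.le]
  have hmeas : Measurable fun γ : (EuclideanSpace ℝ (Fin 3)) => Real.exp (-τ * ‖γ‖ ^ 2) :=
    (by fun_prop : Continuous fun γ : (EuclideanSpace ℝ (Fin 3)) => Real.exp (-τ * ‖γ‖ ^ 2)).measurable
  refine integral_mono (integrable_symbol_mul_gaussWeight hmeas hhb ha)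
    (integrable_symbol_mul_gaussWeight hm hmb ha) fun ξ => ?_
  have hw : 0 ≤ (π / a) ^ ((Module.finrank ℝ (EuclideanSpace ℝ (Fin 3)) : ℝ) / 2) * Real.exp (-(π ^ 2 / a) * ‖ξ‖ ^ 2) := by
    positivity
  exact mul_le_mul_of_nonneg_right (hle _) hw

/-- **`mulOp m g_a` is bounded** when `|m| ≤ 1`: `|mulOp m g_a x| ≤ ∫ ‖m(−2πξ) 𝓕g_a(ξ)‖ dξ`, a
constant independent of `x` (norm of a Fourier integral ≤ integral of the norm). -/
theorem abs_mulOp_gauss_le (m : (EuclideanSpace ℝ (Fin 3)) → ℝ) {a : ℝ} (x : (EuclideanSpace ℝ (Fin 3))) :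
    |mulOp m (fun y : (EuclideanSpace ℝ (Fin 3)) => Real.exp (-a * ‖y‖ ^ 2)) x| ≤
      ∫ ξ : (EuclideanSpace ℝ (Fin 3)), ‖((m (-((2 * π) • ξ)) : ℝ) : ℂ) *
        𝓕 (fun y : (EuclideanSpace ℝ (Fin 3)) => ((Real.exp (-a * ‖y‖ ^ 2) : ℝ) : ℂ)) ξ‖ := by
  unfold mulOp
  refine (Complex.abs_re_le_norm _).trans ?_
  exact VectorFourier.norm_fourierIntegral_le_integral_norm _ _ _ _ _

/-- `BddAbove` form of the previous bound, as needed by `abs_le_supNorm`. -/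
theorem bddAbove_mulOp_gauss (m : (EuclideanSpace ℝ (Fin 3)) → ℝ) (a : ℝ) :
    BddAbove (Set.range fun x : (EuclideanSpace ℝ (Fin 3)) => |mulOp m (fun y : (EuclideanSpace ℝ (Fin 3)) => Real.exp (-a * ‖y‖ ^ 2)) x|) :=
  ⟨_, by rintro _ ⟨x, rfl⟩; exact abs_mulOp_gauss_le m x⟩

/-! ## 3. The probe is an admissible `S`-function with sup-norm `≤ 1`, value `1` at `0` -/

/-- The Gaussian probe is in the paper's class `S` (smooth, Fefferman-(4) decay: it is the Schwartz
function `realGaussianSchwartz`). -/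
theorem inS_gauss {a : ℝ} (ha : 0 < a) : InS (fun y : (EuclideanSpace ℝ (Fin 3)) => Real.exp (-a * ‖y‖ ^ 2)) := by
  refine ⟨Literature.Analysis.FunctionSpaces.contDiff_exp_neg_mul_norm_sq a, ?_⟩
  rw [← Literature.Analysis.FunctionSpaces.coe_realGaussianSchwartz (E := (EuclideanSpace ℝ (Fin 3))) ha]
  exact fun n K => ⟨_, fun x => SchwartzMap.one_add_le_sup_seminorm_apply (𝕜 := ℝ) (m := (K, n))
    le_rfl le_rfl (Literature.Analysis.FunctionSpaces.realGaussianSchwartz (EuclideanSpace ℝ (Fin 3)) a) x⟩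

/-- `supNorm g_a ≤ 1` (`0 < g_a ≤ 1`). -/
theorem supNorm_gauss_le_one {a : ℝ} (ha : 0 ≤ a) :
    supNorm (fun y : (EuclideanSpace ℝ (Fin 3)) => Real.exp (-a * ‖y‖ ^ 2)) ≤ 1 := by
  refine supNorm_le fun x => ?_
  rw [abs_of_pos (Real.exp_pos _), Real.exp_le_one_iff]
  nlinarith [sq_nonneg ‖x‖]

/-! ## 4. Numerics: `ε = e⁻²`, `a = ε³/40`, `τ = 1/ε³` -/

/-- The closed-form value for the chosen constants: `(1/(1+4aτ))^{3/2} = (10/11)^{3/2} ≥ 100/121`. -/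
theorem probe_value_ge (ε : ℝ) (hε : 0 < ε) :
    (100 : ℝ) / 121 ≤ (1 / (1 + 4 * (ε ^ 3 / 40) * (1 / ε ^ 3))) ^ ((Module.finrank ℝ (EuclideanSpace ℝ (Fin 3)) : ℝ) / 2) := by
  have hε3 : ε ^ 3 ≠ 0 := by positivity
  have hbase : 1 / (1 + 4 * (ε ^ 3 / 40) * (1 / ε ^ 3)) = (10 : ℝ) / 11 := by
    field_simp
    ring
  have hn : (Module.finrank ℝ (EuclideanSpace ℝ (Fin 3)) : ℝ) / 2 = (3 : ℝ) / 2 := by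
    rw [finrank_euclideanSpace_fin]
    norm_num
  rw [hbase, hn]
  have h2 : ((10 : ℝ) / 11) ^ (2 : ℝ) = 100 / 121 := by
    rw [show (2 : ℝ) = ((2 : ℕ) : ℝ) by norm_num, Real.rpow_natCast]
    norm_num
  rw [← h2]
  exact Real.rpow_le_rpow_of_exponent_ge (by norm_num) (by norm_num) (by norm_num)

/-! ## 5. The refutations -/

/-- **The number behind `¬ Eq632` / `¬ Step_3`**: for every `ε > 0`, the wide Gaussian
`g = e^{−(ε³/40)|x|²}` has `supNorm (E g) ≥ (E g)(0) ≥ (10/11)^{3/2} ≥ 100/121`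
(heat comparison `1 − δ ≥ exp(−|γ|²/ε³)`). -/
theorem supNorm_opE_gauss_ge {ε : ℝ} (hε : 0 < ε) :
    (100 : ℝ) / 121 ≤ supNorm (opE ε fun y : (EuclideanSpace ℝ (Fin 3)) => Real.exp (-(ε ^ 3 / 40) * ‖y‖ ^ 2)) := by
  have ha : 0 < ε ^ 3 / 40 := by positivity
  have hlow := mulOp_gauss_zero_ge (m := symbE ε) (measurable_symbE ε) (τ := 1 / ε ^ 3)
    (by positivity) ha (fun γ => exp_neg_norm_sq_le_symbE hε γ) (symbE_le_one ε)
  have h0 : mulOp (symbE ε) (fun y : (EuclideanSpace ℝ (Fin 3)) => Real.exp (-(ε ^ 3 / 40) * ‖y‖ ^ 2)) 0 ≤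
      supNorm (opE ε fun y : (EuclideanSpace ℝ (Fin 3)) => Real.exp (-(ε ^ 3 / 40) * ‖y‖ ^ 2)) :=
    (le_abs_self _).trans (abs_le_supNorm (bddAbove_mulOp_gauss (symbE ε) _) 0)
  exact (probe_value_ge ε hε).trans (hlow.trans h0)

/-- **¬ (6.32) (scalar Theorem 6.2, p. 138):** with `ε = e⁻²` and the wide Gaussian
`g = e^{−(ε³/40)|x|²} ∈ S`: `supNorm (E g) ≥ 100/121`, while `ε · supNorm g ≤ e⁻² ≤ 1/3`. Mechanism:
the symbol `1 − δ` equals `1` at `γ = 0`, so `E` is not `ε`-small on `L^∞` (barrier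
`Literature.Barriers.NavierStokesRegularity.SupNormGainObstruction`).
WHAT THIS IS NOT: not a claim about NS regularity or blow-up; not a claim about any author beyond
the typed locator. -/
theorem not_Eq632 : ¬ Eq632 := by
  intro h
  have hε : 0 < Real.exp (-2) := Real.exp_pos _
  have hstep := h (Real.exp (-2)) hε le_rfl (fun y : (EuclideanSpace ℝ (Fin 3)) => Real.exp (-(Real.exp (-2) ^ 3 / 40) * ‖y‖ ^ 2))
    (inS_gauss (by positivity)) ⟨0, by simp⟩
  have h1 := supNorm_opE_gauss_ge hε
  have h2 : Real.exp (-2) * supNorm (fun y : (EuclideanSpace ℝ (Fin 3)) => Real.exp (-(Real.exp (-2) ^ 3 / 40) * ‖y‖ ^ 2)) ≤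
      Real.exp (-2) * 1 := mul_le_mul_of_nonneg_left (supNorm_gauss_le_one (by positivity)) hε.le
  have hε3 : Real.exp (-2) ≤ 1 / 3 := by
    rw [Real.exp_neg]
    exact inv_le_of_inv_le₀ (by norm_num) (by linarith [Real.add_one_le_exp (2 : ℝ)])
  linarith

/-- **¬ Step 3 (Theorem 6.2, (6.33) p. 138, the load-bearing vector form «|E̿·u⃗| < ε|u⃗|»):** the
same witness in all three components, `u⃗ = (g, g, g) ∈ →TS` (`→TS = S ⊕ S ⊕ S`, p. 120, carries no
divergence condition): `vecNorm (E̿ u⃗) = 3·supNorm (E g) ≥ 300/121` while `ε·vecNorm u⃗ ≤ 3ε ≤ 1`.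
WHAT THIS IS NOT: not a claim about NS regularity or blow-up; not a claim about any author beyond
the typed locator. -/
theorem not_Step_3 : ¬ Step_3 := by
  intro h
  have hε : 0 < Real.exp (-2) := Real.exp_pos _
  have hstep := h (Real.exp (-2)) hε le_rfl
    (fun _ : Fin 3 => fun y : (EuclideanSpace ℝ (Fin 3)) => Real.exp (-(Real.exp (-2) ^ 3 / 40) * ‖y‖ ^ 2))
    (fun _ => inS_gauss (by positivity)) ⟨0, 0, by simp⟩
  simp only [vecNorm, Finset.sum_const, Finset.card_univ, Fintype.card_fin, nsmul_eq_mul,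
    Nat.cast_ofNat] at hstep
  have h1 := supNorm_opE_gauss_ge hε
  have h2 : Real.exp (-2) * supNorm (fun y : (EuclideanSpace ℝ (Fin 3)) => Real.exp (-(Real.exp (-2) ^ 3 / 40) * ‖y‖ ^ 2)) ≤
      Real.exp (-2) * 1 := mul_le_mul_of_nonneg_left (supNorm_gauss_le_one (by positivity)) hε.le
  have hε3 : Real.exp (-2) ≤ 1 / 3 := by
    rw [Real.exp_neg]
    exact inv_le_of_inv_le₀ (by norm_num) (by linarith [Real.add_one_le_exp (2 : ℝ)])
  nlinarith

/-- **¬ Step 3Abs (the printed inference (6.25)–(6.32) at the grain the proof uses it):** the heat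
symbol `m(γ) = exp(−|γ|²/ε³)` with `ε = e⁻²` satisfies every printed hypothesis — continuous, even,
`0 < m ≤ 1` ((6.22)), and `m ≤ e^{−1/ε} ≤ ε` wherever `|γ|² ≥ ε²` ((6.28)) — yet `T_m = e^{Δ/ε³}`
(paper convention `F⁻¹[m F·]`) moves the wide Gaussian `g = e^{−(ε³/40)|x|²}` by less than 10%:
`supNorm (T_m g) ≥ (10/11)^{3/2} ≥ 100/121 > ε·supNorm g`. The `L^∞ → L^∞` size of a multiplier is
the total variation of its kernel (`= 1` here), not the sup of the symbol off a small ball (barrier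
`Literature.Barriers.NavierStokesRegularity.exists_schwartz_heatExtension_gt`).
WHAT THIS IS NOT: not a claim about NS regularity or blow-up; not a claim about any author beyond
the typed locator. -/
theorem not_Step_3Abs : ¬ Step_3Abs := by
  intro h
  set ε : ℝ := Real.exp (-2) with hε_def
  have hε : 0 < ε := Real.exp_pos _
  set a : ℝ := ε ^ 3 / 40 with ha_def
  have ha : 0 < a := by positivity
  set τ : ℝ := 1 / ε ^ 3 with hτ_def
  have hτ : 0 < τ := by positivity
  have hcont : Continuous fun γ : (EuclideanSpace ℝ (Fin 3)) => Real.exp (-τ * ‖γ‖ ^ 2) := by fun_prop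
  have heven : ∀ γ : (EuclideanSpace ℝ (Fin 3)), Real.exp (-τ * ‖-γ‖ ^ 2) = Real.exp (-τ * ‖γ‖ ^ 2) := fun γ => by
    rw [norm_neg]
  have hpos : ∀ γ : (EuclideanSpace ℝ (Fin 3)), 0 < Real.exp (-τ * ‖γ‖ ^ 2) ∧ Real.exp (-τ * ‖γ‖ ^ 2) ≤ 1 := fun γ => by
    refine ⟨Real.exp_pos _, ?_⟩
    rw [Real.exp_le_one_iff]
    nlinarith [sq_nonneg ‖γ‖, hτ.le]
  have hε2 : (2 : ℝ) ≤ 1 / ε := by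
    rw [hε_def, Real.exp_neg, one_div, inv_inv]
    linarith [Real.add_one_le_exp (2 : ℝ)]
  have hoff : ∀ γ : (EuclideanSpace ℝ (Fin 3)), ε ^ 2 ≤ ‖γ‖ ^ 2 → Real.exp (-τ * ‖γ‖ ^ 2) ≤ ε := fun γ hγ => by
    have hε3 : 0 < ε ^ 3 := by positivity
    have h1 : -τ * ‖γ‖ ^ 2 ≤ -(1 / ε) := by
      rw [hτ_def]
      have : ε ^ 2 / ε ^ 3 = 1 / ε := by field_simp
      rw [← this]
      have h2 : ε ^ 2 * (1 / ε ^ 3) ≤ ‖γ‖ ^ 2 * (1 / ε ^ 3) :=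
        mul_le_mul_of_nonneg_right hγ (by positivity)
      have h3 : ε ^ 2 / ε ^ 3 = ε ^ 2 * (1 / ε ^ 3) := by ring
      rw [h3]
      linarith
    calc Real.exp (-τ * ‖γ‖ ^ 2) ≤ Real.exp (-(1 / ε)) := Real.exp_le_exp.2 h1
      _ ≤ Real.exp (-2) := Real.exp_le_exp.2 (by linarith)
      _ = ε := rfl
  have hstep := h ε hε le_rfl (fun γ : (EuclideanSpace ℝ (Fin 3)) => Real.exp (-τ * ‖γ‖ ^ 2)) hcont heven hpos hoff
    (fun y : (EuclideanSpace ℝ (Fin 3)) => Real.exp (-a * ‖y‖ ^ 2)) (inS_gauss ha) ⟨0, by simp⟩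
  have hlow := mulOp_gauss_zero_ge (m := fun γ : (EuclideanSpace ℝ (Fin 3)) => Real.exp (-τ * ‖γ‖ ^ 2))
    hcont.measurable hτ ha (fun γ => le_rfl) (fun γ => (hpos γ).2)
  have hval : (100 : ℝ) / 121 ≤ (1 / (1 + 4 * a * τ)) ^ ((Module.finrank ℝ (EuclideanSpace ℝ (Fin 3)) : ℝ) / 2) := by
    rw [ha_def, hτ_def]
    exact probe_value_ge ε hε
  have h0 : mulOp (fun γ : (EuclideanSpace ℝ (Fin 3)) => Real.exp (-τ * ‖γ‖ ^ 2)) (fun y : (EuclideanSpace ℝ (Fin 3)) => Real.exp (-a * ‖y‖ ^ 2)) 0 ≤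
      supNorm (mulOp (fun γ : (EuclideanSpace ℝ (Fin 3)) => Real.exp (-τ * ‖γ‖ ^ 2)) fun y : (EuclideanSpace ℝ (Fin 3)) => Real.exp (-a * ‖y‖ ^ 2)) :=
    (le_abs_self _).trans (abs_le_supNorm (bddAbove_mulOp_gauss _ a) 0)
  have hg : supNorm (fun y : (EuclideanSpace ℝ (Fin 3)) => Real.exp (-a * ‖y‖ ^ 2)) ≤ 1 := supNorm_gauss_le_one ha.le
  have hε3 : ε ≤ 1 / 3 := by
    rw [hε_def, Real.exp_neg]
    exact inv_le_of_inv_le₀ (by norm_num) (by linarith [Real.add_one_le_exp (2 : ℝ)])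
  have : ε * supNorm (fun y : (EuclideanSpace ℝ (Fin 3)) => Real.exp (-a * ‖y‖ ^ 2)) ≤ 1 / 3 := by
    calc ε * supNorm (fun y : (EuclideanSpace ℝ (Fin 3)) => Real.exp (-a * ‖y‖ ^ 2)) ≤ ε * 1 :=
          mul_le_mul_of_nonneg_left hg hε.le
      _ ≤ 1 / 3 := by linarith
  have hchain : (100 : ℝ) / 121 < 1 / 3 :=
    calc (100 : ℝ) / 121 ≤ _ := hval
      _ ≤ _ := hlow
      _ ≤ _ := h0
      _ < _ := hstep
      _ ≤ 1 / 3 := this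
  norm_num at hchain

end Summit.NavierStokesRegularity.NavierStokesRegularity.Theorems.Tsionskiy2025
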